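import Mathlib.Combinatorics.SimpleGraph.Clique
import Mathlib.Data.Fintype.Powerset
import Literature.Computability.Complexity.CNF
import HarnessLib

/-!
# The non-arrowing CNF of a graph: 2-colourings of the pairs with no monochromatic `k`-clique

For a graph `G` on `Fin n` and `k : ℕ`, `nonArrowingCNF G k : CNF ℕ`
(`Literature.Computability.Complexity.CNF`, clause lists over `ℕ`-indexed variables) is the
propositional statement "`G ↛ (K_k)_2`": the variable `x_{u·n+v}` is the colour of the pair
`{u < v}` of vertices, and every `k`-clique `S` of `G` contributes the two NOT-ALL-EQUAL clauses
`⋁_{u<v ∈ S} x_{u·n+v}` and `⋁_{u<v ∈ S} ¬x_{u·n+v}` ("`S` is not monochromatic"). For `G = K_n` this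
is the clause set `¬RAM_n` of proof complexity (Krajíček, *Proof Complexity*, Ch. 13, PDF p. 256:
atoms `r_e`, `e ∈ ([n] choose 2)`, and for each `H` the clauses `⋁_{e ⊆ H} r_e`, `⋁_{e ⊆ H} ¬r_e`);
route PneNP/RamseyThreshold INLINES exactly this clause list (with `k = 4`, resp. `k = 3`) inside
`SOSFailsToRefute` in its cruxes `SosBlindAboveThreshold` / `TriangleArrowingSosEasy`, and the
definition below is that expression verbatim with `4 ↦ k` (so the bridge is definitional, up to
the `Decidable` instances found at the use site).

* `mem_nonArrowingCNF_iff` — the clauses are the positive / negative pair clauses of the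
  `k`-cliques;
* `eval_pairClause_iff` — a pair clause of `S` with polarity `b` is true under `σ` iff some pair
  `u < v` of `S` has `σ (u·n+v) = b`;
* `satisfiable_nonArrowingCNF_iff` — **semantics**: `nonArrowingCNF G k` is satisfiable iff some
  colouring `c : Sym2 (Fin n) → Bool` of the pairs leaves no `k`-clique of `G` monochromatic,
  stated in the elementary form `∃ c, ∀ S, G.IsNClique k S → ∀ b, ∃ u ∈ S, ∃ v ∈ S, u ≠ v ∧
  c s(u, v) ≠ b` which is (i) literally the non-arrowing predicate inlined in the route's
  `QuietNonArrowingPlanting` / `NonArrowingMemNP` and (ii) the right-hand side of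
  `Literature.Combinatorics.SimpleGraph.not_arrowsCliques_two_iff`
  (file `ArrowsCliques.lean`), i.e. `¬ ArrowsCliques G k 2`.

Design: this file deliberately does not import `ArrowsCliques.lean` (pure combinatorics) nor is
imported by it (the CNF vocabulary pulls in the complexity core); the one-line combination with
`not_arrowsCliques_two_iff` is left to the user. Edge cases are faithful: for `k ≤ 1` every
`k`-clique yields the EMPTY clause (no pairs), so the CNF is unsatisfiable as soon as a `k`-clique
exists — matching `ArrowsCliques G k 2` being (vacuously) true there.

## References

* [Krajicek2019] J. Krajíček, *Proof Complexity*, CUP 2019, Ch. 13 (PDF p. 256: the Ramsey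
  formula `RAM_n` and its negation as a clause set). Read via `lit read` (p. 256).
* Route PneNP/RamseyThreshold (tree: `Summits/PneNP/PneNP/Theses/RamseyThreshold.lean`, items
  `SosBlindAboveThreshold`, `TriangleArrowingSosEasy`, `NonArrowingMemNP`).
-/

namespace Literature.Combinatorics.SimpleGraph

open Finset
open _root_.SimpleGraph
open Literature.Computability.Complexity

variable {n : ℕ}

/-- The **pair clause** of a vertex set `S ⊆ Fin n` with polarity `b`: the literals
`(u·n+v, b)` for the ordered pairs `u < v` of elements of `S` (listed in `Finset.toList` order).
With `b = true` it says "some pair of `S` has colour `true`", with `b = false` "some pair has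
colour `false`". [folklore] -/
noncomputable def pairClause (S : Finset (Fin n)) (b : Bool) : Clause ℕ :=
  ((S ×ˢ S).filter fun q : Fin n × Fin n => q.1 < q.2).toList.map fun q =>
    ((q.1 : ℕ) * n + (q.2 : ℕ), b)

/-- The **non-arrowing CNF** of `G` for `k`-cliques and two colours: variables `u·n+v` = colour
of the pair `{u < v}`; for every `k`-clique `S` of `G` (in `Finset.toList` order of
`univ.filter (G.IsNClique k ·)`) the two clauses `pairClause S true = ⋁ x_e` and
`pairClause S false = ⋁ ¬x_e`. Written out literally as in route PneNP/RamseyThreshold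
(`SosBlindAboveThreshold` has this expression with `k = 4`). Its satisfying assignments are the
2-colourings of the pairs with no monochromatic `k`-clique of `G`
(`satisfiable_nonArrowingCNF_iff`); for `G = K_n` it is Krajíček's clause set `¬RAM_n`
(Proof Complexity, Ch. 13, PDF p. 256) with clique size `k`. [folklore] -/
noncomputable def nonArrowingCNF (G : _root_.SimpleGraph (Fin n)) [DecidableRel G.Adj] (k : ℕ) :
    CNF ℕ :=
  (Finset.univ.filter fun S : Finset (Fin n) => G.IsNClique k S).toList.flatMap fun S =>
    [((S ×ˢ S).filter fun q : Fin n × Fin n => q.1 < q.2).toList.map fun q =>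
        ((q.1 : ℕ) * n + (q.2 : ℕ), true),
      ((S ×ˢ S).filter fun q : Fin n × Fin n => q.1 < q.2).toList.map fun q =>
        ((q.1 : ℕ) * n + (q.2 : ℕ), false)]

/-- Unfolding: the non-arrowing CNF lists, for each `k`-clique, its two pair clauses. [folklore] -/
theorem nonArrowingCNF_eq (G : _root_.SimpleGraph (Fin n)) [DecidableRel G.Adj] (k : ℕ) :
    nonArrowingCNF G k =
      (Finset.univ.filter fun S : Finset (Fin n) => G.IsNClique k S).toList.flatMap fun S =>
        [pairClause S true, pairClause S false] :=
  rfl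

/-- The clauses of `nonArrowingCNF G k` are exactly the pair clauses (both polarities) of the
`k`-cliques of `G`. [folklore] -/
theorem mem_nonArrowingCNF_iff (G : _root_.SimpleGraph (Fin n)) [DecidableRel G.Adj] (k : ℕ)
    (C : Clause ℕ) :
    C ∈ nonArrowingCNF G k ↔
      ∃ S : Finset (Fin n), G.IsNClique k S ∧ (C = pairClause S true ∨ C = pairClause S false) := by
  rw [nonArrowingCNF_eq]
  simp only [List.mem_flatMap, Finset.mem_toList, Finset.mem_filter, Finset.mem_univ, true_and,
    List.mem_cons, List.not_mem_nil, or_false]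

/-- A pair clause of `S` with polarity `b` is true under `σ` iff some pair `u < v` of elements of
`S` has `σ (u·n+v) = b`. [folklore] -/
theorem eval_pairClause_iff (σ : ℕ → Bool) (S : Finset (Fin n)) (b : Bool) :
    Clause.eval σ (pairClause S b) = true ↔
      ∃ u ∈ S, ∃ v ∈ S, u < v ∧ σ ((u : ℕ) * n + (v : ℕ)) = b := by
  simp only [Clause.eval, pairClause, List.any_map, List.any_eq_true, Function.comp_apply,
    Literal.eval, beq_iff_eq, Finset.mem_toList, Finset.mem_filter, Finset.mem_product,
    Prod.exists]
  constructor
  · rintro ⟨u, v, ⟨⟨hu, hv⟩, huv⟩, h⟩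
    exact ⟨u, hu, v, hv, huv, h⟩
  · rintro ⟨u, hu, v, hv, huv, h⟩
    exact ⟨u, v, ⟨⟨hu, hv⟩, huv⟩, h⟩

/-- Decoding the pair code: `(u·n+v) / n % n = u` for `u, v < n`. [folklore] -/
theorem pairCode_div_mod (u v : Fin n) : ((u : ℕ) * n + (v : ℕ)) / n % n = u := by
  have hn : 0 < n := u.pos
  rw [Nat.add_comm, Nat.add_mul_div_right _ _ hn, Nat.div_eq_of_lt v.isLt, Nat.zero_add,
    Nat.mod_eq_of_lt u.isLt]

/-- Decoding the pair code: `(u·n+v) % n = v` for `u, v < n`. [folklore] -/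
theorem pairCode_mod (u v : Fin n) : ((u : ℕ) * n + (v : ℕ)) % n = v := by
  rw [Nat.add_comm, Nat.add_mul_mod_self_right, Nat.mod_eq_of_lt v.isLt]

/-- From "some two distinct vertices of `S` get a colour `≠ b`" to an ORDERED pair `u < v` of `S`
with colour `!b`. [folklore] -/
theorem exists_lt_of_exists_ne_color {S : Finset (Fin n)} {c : Sym2 (Fin n) → Bool} {b : Bool}
    (h : ∃ u ∈ S, ∃ v ∈ S, u ≠ v ∧ c s(u, v) ≠ b) :
    ∃ u ∈ S, ∃ v ∈ S, u < v ∧ c s(u, v) = !b := by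
  obtain ⟨u, hu, v, hv, huv, hc⟩ := h
  have hc' : c s(u, v) = !b := by
    cases b <;> simpa using hc
  rcases lt_or_gt_of_ne huv with hlt | hlt
  · exact ⟨u, hu, v, hv, hlt, hc'⟩
  · exact ⟨v, hv, u, hu, hlt, by rwa [Sym2.eq_swap]⟩

/-- **Semantics of the non-arrowing CNF.** `nonArrowingCNF G k` is satisfiable iff there is a
2-colouring `c` of the unordered pairs of vertices under which NO `k`-clique of `G` is
monochromatic, i.e. for every `k`-clique `S` and each colour `b` some two distinct vertices of `S`
span a pair of colour `≠ b`. The right-hand side is literally the non-arrowing predicate inlined in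
route PneNP/RamseyThreshold and the right-hand side of
`Literature.Combinatorics.SimpleGraph.not_arrowsCliques_two_iff` (`= ¬ ArrowsCliques G k 2`).
(→: colour `s(u, v)` by `σ (min·n + max)`; ←: set `σ m := c s(m / n % n, m % n)`.) [folklore] -/
theorem satisfiable_nonArrowingCNF_iff (G : _root_.SimpleGraph (Fin n)) [DecidableRel G.Adj]
    (k : ℕ) :
    (nonArrowingCNF G k).Satisfiable ↔
      ∃ c : Sym2 (Fin n) → Bool, ∀ S : Finset (Fin n), G.IsNClique k S →
        ∀ b : Bool, ∃ u ∈ S, ∃ v ∈ S, u ≠ v ∧ c s(u, v) ≠ b := by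
  constructor
  · rintro ⟨σ, hσ⟩
    rw [CNF.eval_eq_true_iff] at hσ
    -- the colour of the pair `{u, v}` is the value of the variable `min·n + max`
    have hsymm : ∀ u v : Fin n, σ (((min u v : Fin n) : ℕ) * n + ((max u v : Fin n) : ℕ)) =
        σ (((min v u : Fin n) : ℕ) * n + ((max v u : Fin n) : ℕ)) := fun u v => by
      rw [min_comm, max_comm]
    refine ⟨Sym2.lift ⟨fun u v => σ (((min u v : Fin n) : ℕ) * n + ((max u v : Fin n) : ℕ)),
      hsymm⟩, ?_⟩
    intro S hS b
    -- use the clause of the OPPOSITE polarity `!b`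
    have hmem : pairClause S (!b) ∈ nonArrowingCNF G k :=
      (mem_nonArrowingCNF_iff G k _).2 ⟨S, hS, by cases b <;> simp⟩
    obtain ⟨u, hu, v, hv, huv, huvσ⟩ := (eval_pairClause_iff σ S (!b)).1 (hσ _ hmem)
    refine ⟨u, hu, v, hv, huv.ne, ?_⟩
    show σ (((min u v : Fin n) : ℕ) * n + ((max u v : Fin n) : ℕ)) ≠ b
    rw [min_eq_left huv.le, max_eq_right huv.le, huvσ]
    cases b <;> decide
  · rintro ⟨c, hc⟩
    -- the assignment: variable `m` gets the colour of the pair it codes (junk `false` if `n = 0`)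
    let σ : ℕ → Bool := fun m =>
      if h : 0 < n then c s(⟨m / n % n, Nat.mod_lt _ h⟩, ⟨m % n, Nat.mod_lt _ h⟩) else false
    -- decoding on genuine pair codes
    have hdecode : ∀ u v : Fin n, σ ((u : ℕ) * n + (v : ℕ)) = c s(u, v) := by
      intro u v
      have hn : 0 < n := u.pos
      have h1 : (⟨((u : ℕ) * n + (v : ℕ)) / n % n, Nat.mod_lt _ hn⟩ : Fin n) = u :=
        Fin.ext (pairCode_div_mod u v)
      have h2 : (⟨((u : ℕ) * n + (v : ℕ)) % n, Nat.mod_lt _ hn⟩ : Fin n) = v :=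
        Fin.ext (pairCode_mod u v)
      simp only [σ, dif_pos hn, h1, h2]
    refine ⟨σ, ?_⟩
    rw [CNF.eval_eq_true_iff]
    intro C hC
    obtain ⟨S, hS, hCS⟩ := (mem_nonArrowingCNF_iff G k C).1 hC
    -- a clause of polarity `b'` is satisfied thanks to a pair of colour `≠ !b'`
    have key : ∀ b' : Bool, Clause.eval σ (pairClause S b') = true := by
      intro b'
      rw [eval_pairClause_iff]
      obtain ⟨u, hu, v, hv, huv, huvc⟩ := exists_lt_of_exists_ne_color (hc S hS (!b'))
      refine ⟨u, hu, v, hv, huv, ?_⟩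
      rw [hdecode u v, huvc, Bool.not_not]
    rcases hCS with rfl | rfl
    · exact key true
    · exact key false

end Literature.Combinatorics.SimpleGraph
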